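import Literature.Geometry.Lorentzian.SchwarzschildKerrSchildComponents

/-!
# Route EIHFluxBalance — `InertialRecession` (E′), stub `stub_slaving`:
# the Lie derivative of the static Schwarzschild Kerr–Schild components along a boost-and-translation
# generator, in closed form, and the four-point rigidity of its zero set (all boosts)

Helper file for the crux `stmt-FinalStateConjecture-17403`
(`Summit.FinalStateConjecture.FinalStateConjecture.Theses.EIHFluxBalance.InertialRecession`, E′),
stub `stub_slaving` (frozen-vacuum slaving), part (B2) of the all-boost coercivity programme (memo
`COER_allboosts_routes.md`, item evidence): the `J²`-block of the jet ↦ Ricci map of one painted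
Schwarzschild summand is, by the principal-symbol kernel lemma of `…StubSlavingCOERSymbol`, the
question whether an infinitesimal boost-and-translation `Z(x) = ωx + q`, `ω = e₀ ∧ p`, can have
`𝓛_Z g_{M,0} = 0` at the (rest-frame images of the) evaluation events. Here, for the static
components `g_{M,0} = η + (2M/r) ℓ ⊗ ℓ` (`Kerr.bilin M 0`) off the time axis:

* `lieDeriv_bilin_zero_spin_eq` — **closed form**: for `p` (only its spatial part `p⃗` enters),
  any direction `V` and `ωA := (⟪p⃗, A⃗⟫, A⁰ p⃗)`,
  `∂_V g(A,B) + g(ωA, B) + g(A, ωB) = ℓ(A) μ(B) + μ(A) ℓ(B)` with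
  `μ(B) = −(M/r³)⟪x⃗,V⃗⟫ ℓ(B) + (2M/r²) P(V,B) + (2M/r)(⟪p⃗,B⃗⟫ + B⁰ ⟪x⃗,p⃗⟫/r)`
  (`Schwarzschild.fderiv_bilin_zero_spin_apply`; the `η`-part of the `ω`-terms cancels because
  `ω ∈ so(1,3)`). In particular the derivative is a null pair `ℓ ⊗ μ + μ ⊗ ℓ`.
* `spatial_add_eq_of_lieDeriv_eq_zero` — **the zero set at one event**: if `M ≠ 0` and the form
  vanishes at `x` for the direction `V`, then `V⃗ + r p⃗ = (3⟪x⃗,V⃗⟫/(2r²)) x⃗` (test vectors `e₀`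
  and spatial `B`; `μ = 0` because `ℓ(e₀) = 1`).
* `eq_zero_of_four_point_conditions` — **four-point rigidity (pure linear algebra in `E3`)**: if
  `q⃗ + (τₖ + rₖ) p⃗ = (3⟪q⃗ + τₖ p⃗, yₖ⟫/(2rₖ²)) yₖ` for four vectors `yₖ` of which every three are
  linearly independent, with `rₖ ≠ 0`, then `p⃗ = 0` and `q⃗ = 0` (the affine line `q⃗ + ℝp⃗` cannot
  meet four lines through the origin in general position).
* `spatial_eq_zero_of_lieDeriv_eq_zero_four_events` — **(B2) assembled**: if
  `𝓛_Z g_{M,0} = 0` at four events `xₖ` (directions `V_k = Z(xₖ)`, spatial part `q⃗ + xₖ⁰ p⃗`) whose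
  spatial parts are in general position, then `p⃗ = 0` and `q⃗ = 0`: `Z` is the static Killing
  field `q⁰ ∂_t`. Valid for every event configuration, hence — through the Lorentz covariance of the
  painted summand — for every boost of the lab slab.

Elementary; no definitions, no named facts, no `sorry`.
-/

set_option linter.dupNamespace false
set_option maxSynthPendingDepth 3

noncomputable section

open Set Function Module Submodule Literature.Geometry.Lorentzian
  Literature.Geometry.Lorentzian.Schwarzschild
open scoped InnerProductSpace

namespace Summit.FinalStateConjecture.FinalStateConjecture.Theorems.SublinearIsFree.Slaving

/-! ### The Lie derivative of the static Schwarzschild components in closed form -/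

section LieDerivative

variable {x : E4}

/-- `ℓ(ωA) = ⟪p⃗, A⃗⟫ + A⁰ ⟪x⃗, p⃗⟫/r` for `ωA = (⟪p⃗, A⃗⟫, A⁰ p⃗)`. [folklore] -/
theorem ell_omega (x p A : E4) :
    ell x (E4.ofTimeSpace (sdot p A) (A 0 • E4.spatial p)) = sdot p A + A 0 * (sdot x p / E4.spatialNorm x) := by
  simp only [ell, sdot, E4.ofTimeSpace_apply_zero, E4.spatial_ofTimeSpace, inner_smul_right]
  ring

/-- `⟪(ωA)⃗, B⃗⟫ = A⁰ ⟪p⃗, B⃗⟫`. [folklore] -/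
theorem sdot_omega (p A B : E4) :
    sdot (E4.ofTimeSpace (sdot p A) (A 0 • E4.spatial p)) B = A 0 * sdot p B := by
  simp only [sdot, E4.spatial_ofTimeSpace, inner_smul_left, RCLike.conj_to_real]

/-- **The Lie derivative of the static Schwarzschild components along `Z = ωx + q`, `ω = e₀ ∧ p`, in
closed form.** Off the time axis, for every direction `V` (the value `Z(x)`; only `V⃗` enters) and all
`A, B`:
`∂_V g(A,B) + g(ωA, B) + g(A, ωB) = ℓ(A) μ(B) + μ(A) ℓ(B)`,
`μ(B) = −(M/r³)⟪x⃗,V⃗⟫ ℓ(B) + (2M/r)(P(V,B)/r) + (2M/r)(⟪p⃗,B⃗⟫ + B⁰⟪x⃗,p⃗⟫/r)`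
(Kerr–Schild 1965, §2: `𝓛_Z(η + 2Hℓ⊗ℓ) = 2Z(H) ℓ⊗ℓ + 2H(𝓛_Zℓ ⊗ ℓ + ℓ ⊗ 𝓛_Zℓ)`, `𝓛_Zη = 0`).
[cite: KerrSchild1965, §2] -/
theorem lieDeriv_bilin_zero_spin_eq (M : ℝ) (hx : E4.spatial x ≠ 0) (p V A B : E4) :
    fderiv ℝ (Kerr.bilin M 0) x V A B
      + Kerr.bilin M 0 x (E4.ofTimeSpace (sdot p A) (A 0 • E4.spatial p)) B
      + Kerr.bilin M 0 x A (E4.ofTimeSpace (sdot p B) (B 0 • E4.spatial p)) =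
    ell x A * (-(M / E4.spatialNorm x ^ 3) * sdot x V * ell x B
        + 2 * M / E4.spatialNorm x * (proj x V B / E4.spatialNorm x)
        + 2 * M / E4.spatialNorm x * (sdot p B + B 0 * (sdot x p / E4.spatialNorm x)))
    + (-(M / E4.spatialNorm x ^ 3) * sdot x V * ell x A
        + 2 * M / E4.spatialNorm x * (proj x V A / E4.spatialNorm x)
        + 2 * M / E4.spatialNorm x * (sdot p A + A 0 * (sdot x p / E4.spatialNorm x))) * ell x B := by
  have hr : E4.spatialNorm x ≠ 0 := by rwa [E4.spatialNorm, norm_ne_zero_iff]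
  rw [fderiv_bilin_zero_spin_apply M hx, bilin_zero_eq M hx, bilin_zero_eq M hx, ell_omega, ell_omega,
    sdot_omega, sdot_comm A (E4.ofTimeSpace (sdot p B) (B 0 • E4.spatial p)), sdot_omega, dG,
    dEll_eq, dEll_eq]
  simp only [E4.ofTimeSpace_apply_zero, sdot_comm p A, sdot_comm p B]
  field_simp
  ring

/-- **The zero set of the Lie derivative at one event.** If `M ≠ 0` and
`∂_V g(A,B) + g(ωA, B) + g(A, ωB) = 0` for all `A, B` at a point `x` off the time axis, then
`V⃗ + r p⃗ = (3⟪x⃗, V⃗⟫ / (2r²)) x⃗` (`μ = 0` since `ℓ(e₀) = 1`; the time component of `μ` gives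
`2r⟪x⃗,p⃗⟫ = ⟪x⃗,V⃗⟫`, which is this identity paired with `x⃗`; the spatial components give the
identity). [cite: KerrSchild1965, §2] -/
theorem spatial_add_eq_of_lieDeriv_eq_zero {M : ℝ} (hM : M ≠ 0) (hx : E4.spatial x ≠ 0) {p V : E4}
    (h : ∀ A B : E4, fderiv ℝ (Kerr.bilin M 0) x V A B
      + Kerr.bilin M 0 x (E4.ofTimeSpace (sdot p A) (A 0 • E4.spatial p)) B
      + Kerr.bilin M 0 x A (E4.ofTimeSpace (sdot p B) (B 0 • E4.spatial p)) = 0) :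
    E4.spatial V + E4.spatialNorm x • E4.spatial p =
      (3 * sdot x V / (2 * E4.spatialNorm x ^ 2)) • E4.spatial x := by
  have hr : E4.spatialNorm x ≠ 0 := by rwa [E4.spatialNorm, norm_ne_zero_iff]
  -- the covector `μ`
  set μ : E4 → ℝ := fun B ↦ -(M / E4.spatialNorm x ^ 3) * sdot x V * ell x B
      + 2 * M / E4.spatialNorm x * (proj x V B / E4.spatialNorm x)
      + 2 * M / E4.spatialNorm x * (sdot p B + B 0 * (sdot x p / E4.spatialNorm x)) with hμ
  have hpair : ∀ A B : E4, ell x A * μ B + μ A * ell x B = 0 := by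
    intro A B
    have h1 := h A B
    rw [lieDeriv_bilin_zero_spin_eq M hx] at h1
    simpa only [hμ] using h1
  -- test vector `e₀ = (1, 0)`: `ℓ(e₀) = 1`
  have hell₀ : ell x (E4.ofTimeSpace 1 0) = 1 := by
    simp [ell, sdot]
  have hμ₀ : μ (E4.ofTimeSpace 1 0) = 0 := by
    have h1 := hpair (E4.ofTimeSpace 1 0) (E4.ofTimeSpace 1 0)
    rw [hell₀] at h1
    linarith
  have hμB : ∀ B : E4, μ B = 0 := by
    intro B
    have h1 := hpair (E4.ofTimeSpace 1 0) B
    rw [hell₀, hμ₀, zero_mul, add_zero, one_mul] at h1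
    exact h1
  -- spatial components: pair with an arbitrary spatial vector `b`
  have key : ∀ b : E3, 2 * E4.spatialNorm x ^ 2 * (⟪E4.spatial V, b⟫_ℝ + E4.spatialNorm x * ⟪E4.spatial p, b⟫_ℝ)
      = 3 * ⟪E4.spatial x, E4.spatial V⟫_ℝ * ⟪E4.spatial x, b⟫_ℝ := by
    intro b
    have h1 := hμB (E4.ofTimeSpace 0 b)
    simp only [hμ, ell, sdot, proj, E4.ofTimeSpace_apply_zero, E4.spatial_ofTimeSpace, zero_add,
      zero_mul, add_zero] at h1
    field_simp at h1
    have h2 : M * (2 * E4.spatialNorm x ^ 2 * (⟪E4.spatial V, b⟫_ℝ + E4.spatialNorm x * ⟪E4.spatial p, b⟫_ℝ)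
        - 3 * ⟪E4.spatial x, E4.spatial V⟫_ℝ * ⟪E4.spatial x, b⟫_ℝ) = 0 := by
      linear_combination h1
    linarith [(mul_eq_zero.1 h2).resolve_left hM]
  apply ext_inner_right ℝ
  intro b
  rw [inner_add_left, inner_smul_left, inner_smul_left, RCLike.conj_to_real, RCLike.conj_to_real]
  have h3 := key b
  simp only [sdot]
  field_simp
  linear_combination h3

end LieDerivative

/-! ### Four-point rigidity: linear algebra in `E3` -/

section Rigidity

/-- Three linearly independent vectors of `E3` do not lie in a subspace of dimension `≤ 2`.
[folklore] -/
theorem false_of_linearIndependent_three_mem {a b c : E3} (h : LinearIndependent ℝ ![a, b, c])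
    {W : Submodule ℝ E3} (hW : Module.finrank ℝ W ≤ 2) (ha : a ∈ W) (hb : b ∈ W) (hc : c ∈ W) :
    False := by
  have h1 : Module.finrank ℝ (span ℝ (Set.range ![a, b, c])) = 3 := by
    rw [finrank_span_eq_card h, Fintype.card_fin]
  have h2 : span ℝ (Set.range ![a, b, c]) ≤ W := by
    rw [span_le]
    rintro _ ⟨i, rfl⟩
    fin_cases i
    · exact ha
    · exact hb
    · exact hc
  have h3 := Submodule.finrank_mono h2
  omega

/-- `span {u, v}` has dimension `≤ 2`. [folklore] -/
theorem finrank_span_pair_le_two (u v : E3) :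
    Module.finrank ℝ (span ℝ ({u, v} : Set E3)) ≤ 2 := by
  classical
  have h := finrank_span_finset_le_card (R := ℝ) (M := E3) ({u, v} : Finset E3)
  rw [Finset.coe_insert, Finset.coe_singleton] at h
  exact h.trans Finset.card_le_two

/-- A vector of `E3` orthogonal to three linearly independent vectors vanishes. [folklore] -/
theorem eq_zero_of_inner_linearIndependent_three {a b c p : E3} (h : LinearIndependent ℝ ![a, b, c])
    (ha : ⟪p, a⟫_ℝ = 0) (hb : ⟪p, b⟫_ℝ = 0) (hc : ⟪p, c⟫_ℝ = 0) : p = 0 := by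
  have htop : span ℝ (Set.range ![a, b, c]) = ⊤ :=
    h.span_eq_top_of_card_eq_finrank' (by rw [Fintype.card_fin, finrank_euclideanSpace_fin])
  have hp : p ∈ span ℝ (Set.range ![a, b, c]) := by rw [htop]; exact mem_top
  obtain ⟨d, hd⟩ := (Submodule.mem_span_range_iff_exists_fun ℝ).1 hp
  have h0 : ⟪p, p⟫_ℝ = 0 := by
    nth_rewrite 2 [← hd]
    rw [inner_sum]
    simp [Fin.sum_univ_three, inner_smul_right, ha, hb, hc]
  exact inner_self_eq_zero.1 h0

/-- **Four-point rigidity.** Let `p, q ∈ E3`, reals `τₖ`, `rₖ ≠ 0` and four vectors `yₖ` of which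
every three are linearly independent. If for every `k`
`q + (τₖ + rₖ) p = (3⟪q + τₖ p, yₖ⟫ / (2 rₖ²)) yₖ` (the zero-set condition of
`spatial_add_eq_of_lieDeriv_eq_zero` at the event `(τₖ, yₖ)` for the generator `Z(x) = ωx + q`,
`ω = e₀ ∧ p`, whose spatial part at time `τ` is `q + τ p`), then `p = 0` and `q = 0`: the points
`q + (τₖ + rₖ)p` of the affine line `q + ℝp` would lie on four lines through the origin in general
position. [folklore] -/
theorem eq_zero_of_four_point_conditions (p q : E3) (y : Fin 4 → E3) (τ r : Fin 4 → ℝ)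
    (hr : ∀ k, r k ≠ 0)
    (hind : ∀ i j k : Fin 4, i ≠ j → j ≠ k → i ≠ k → LinearIndependent ℝ ![y i, y j, y k])
    (hcond : ∀ k, q + (τ k + r k) • p = (3 * ⟪q + τ k • p, y k⟫_ℝ / (2 * r k ^ 2)) • y k) :
    p = 0 ∧ q = 0 := by
  have hy0 : ∀ k, y k ≠ 0 := by
    intro k
    obtain ⟨j, l, hkj, hjl, hkl⟩ : ∃ j l : Fin 4, k ≠ j ∧ j ≠ l ∧ k ≠ l := by
      revert k; decide
    have h := (hind k j l hkj hjl hkl).ne_zero 0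
    simpa using h
  -- Step A: `p = 0`
  have hp : p = 0 := by
    by_contra hp
    -- Step A1: `q ∈ ℝ p`
    have hq : ∃ lam : ℝ, q = lam • p := by
      by_contra hnot
      push Not at hnot
      have hW : ∀ k, (3 * ⟪q + τ k • p, y k⟫_ℝ / (2 * r k ^ 2)) • y k ∈ span ℝ ({p, q} : Set E3) := by
        intro k
        rw [← hcond k]
        exact add_mem (subset_span (by simp)) (smul_mem _ _ (subset_span (by simp)))
      -- among `0, 1, 2` some coefficient vanishes
      have hex : ∃ k : Fin 4, 3 * ⟪q + τ k • p, y k⟫_ℝ / (2 * r k ^ 2) = 0 := by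
        by_contra hne
        push Not at hne
        have hli : LinearIndependent ℝ
            ![(3 * ⟪q + τ 0 • p, y 0⟫_ℝ / (2 * r 0 ^ 2)) • y 0,
              (3 * ⟪q + τ 1 • p, y 1⟫_ℝ / (2 * r 1 ^ 2)) • y 1,
              (3 * ⟪q + τ 2 • p, y 2⟫_ℝ / (2 * r 2 ^ 2)) • y 2] := by
          have h := (hind 0 1 2 (by decide) (by decide) (by decide)).units_smul
            (fun i ↦ Units.mk0 (![3 * ⟪q + τ 0 • p, y 0⟫_ℝ / (2 * r 0 ^ 2),
              3 * ⟪q + τ 1 • p, y 1⟫_ℝ / (2 * r 1 ^ 2),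
              3 * ⟪q + τ 2 • p, y 2⟫_ℝ / (2 * r 2 ^ 2)] i) (by fin_cases i <;> simp [hne]))
          convert h using 1
          funext i
          fin_cases i <;> simp [Units.smul_def]
        exact false_of_linearIndependent_three_mem hli (finrank_span_pair_le_two p q)
          (hW 0) (hW 1) (hW 2)
      obtain ⟨k, hk⟩ := hex
      have h1 := hcond k
      rw [hk, zero_smul] at h1
      exact hnot (-(τ k + r k)) (by rw [neg_smul, eq_neg_iff_add_eq_zero, h1])
    obtain ⟨lam, rfl⟩ := hq
    -- Step A2: the equations now read `(lam + τ k + r k) • p = c k • y k`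
    have hcoef : ∀ k, 3 * ⟪lam • p + τ k • p, y k⟫_ℝ / (2 * r k ^ 2) =
        3 * ((lam + τ k) * ⟪p, y k⟫_ℝ) / (2 * r k ^ 2) := by
      intro k; rw [← add_smul, inner_smul_left, RCLike.conj_to_real]
    have heq : ∀ k, (lam + τ k + r k) • p =
        (3 * ((lam + τ k) * ⟪p, y k⟫_ℝ) / (2 * r k ^ 2)) • y k := by
      intro k; rw [← hcoef k, ← hcond k, ← add_smul, add_assoc]
    -- if `lam + τ k + r k ≠ 0` then `y k ∈ ℝ p`
    have hT : ∀ k, lam + τ k + r k ≠ 0 → y k ∈ span ℝ ({p} : Set E3) := by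
      intro k hk
      have h1 := heq k
      set ck := 3 * ((lam + τ k) * ⟪p, y k⟫_ℝ) / (2 * r k ^ 2) with hck
      have hck0 : ck ≠ 0 := by
        intro h0
        rw [h0, zero_smul, smul_eq_zero] at h1
        exact h1.elim hk hp
      have : y k = (ck⁻¹ * (lam + τ k + r k)) • p := by
        rw [← smul_smul, h1, smul_smul, inv_mul_cancel₀ hck0, one_smul]
      rw [this]
      exact smul_mem _ _ (subset_span rfl)
    -- if `lam + τ k + r k = 0` then `p ⊥ y k`
    have hperp : ∀ k, lam + τ k + r k = 0 → ⟪p, y k⟫_ℝ = 0 := by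
      intro k hk
      have h1 := heq k
      rw [hk, zero_smul] at h1
      have hck0 := (smul_eq_zero.1 h1.symm).resolve_right (hy0 k)
      have h2 : (lam + τ k) * ⟪p, y k⟫_ℝ = 0 := by
        have h3 : 3 * ((lam + τ k) * ⟪p, y k⟫_ℝ) = 0 := by
          rw [div_eq_zero_iff] at hck0
          exact hck0.resolve_right (mul_ne_zero two_ne_zero (pow_ne_zero 2 (hr k)))
        linarith
      refine (mul_eq_zero.1 h2).resolve_left ?_
      intro h0; apply hr k; linarith
    -- two indices with `lam + τ + r ≠ 0` are impossible
    have hTT : ∀ j k, j ≠ k → lam + τ j + r j ≠ 0 → lam + τ k + r k ≠ 0 → False := by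
      have hexl : ∀ j k : Fin 4, ∃ l : Fin 4, j ≠ l ∧ k ≠ l := by decide
      intro j k hjk hj hk
      obtain ⟨l, hjl, hkl⟩ := hexl j k
      have hli := hind j k l hjk hkl hjl
      refine false_of_linearIndependent_three_mem hli (finrank_span_pair_le_two p (y l)) ?_ ?_
        (subset_span (by simp))
      · exact span_mono (by simp) (hT j hj)
      · exact span_mono (by simp) (hT k hk)
    -- hence three indices with `lam + τ + r = 0`
    obtain ⟨i, j, k, hij, hjk, hik, hi, hj, hk⟩ : ∃ i j k : Fin 4, i ≠ j ∧ j ≠ k ∧ i ≠ k ∧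
        lam + τ i + r i = 0 ∧ lam + τ j + r j = 0 ∧ lam + τ k + r k = 0 := by
      by_cases h0 : lam + τ 0 + r 0 = 0
      · by_cases h1 : lam + τ 1 + r 1 = 0
        · by_cases h2 : lam + τ 2 + r 2 = 0
          · exact ⟨0, 1, 2, by decide, by decide, by decide, h0, h1, h2⟩
          · have h3 : lam + τ 3 + r 3 = 0 := by
              by_contra h3; exact hTT 2 3 (by decide) h2 h3
            exact ⟨0, 1, 3, by decide, by decide, by decide, h0, h1, h3⟩
        · have h2 : lam + τ 2 + r 2 = 0 := by
            by_contra h2; exact hTT 1 2 (by decide) h1 h2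
          have h3 : lam + τ 3 + r 3 = 0 := by
            by_contra h3; exact hTT 1 3 (by decide) h1 h3
          exact ⟨0, 2, 3, by decide, by decide, by decide, h0, h2, h3⟩
      · have h1 : lam + τ 1 + r 1 = 0 := by
          by_contra h1; exact hTT 0 1 (by decide) h0 h1
        have h2 : lam + τ 2 + r 2 = 0 := by
          by_contra h2; exact hTT 0 2 (by decide) h0 h2
        have h3 : lam + τ 3 + r 3 = 0 := by
          by_contra h3; exact hTT 0 3 (by decide) h0 h3
        exact ⟨1, 2, 3, by decide, by decide, by decide, h1, h2, h3⟩
    exact hp (eq_zero_of_inner_linearIndependent_three (hind i j k hij hjk hik)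
      (hperp i hi) (hperp j hj) (hperp k hk))
  -- Step B: `q = 0`
  subst hp
  refine ⟨rfl, ?_⟩
  by_contra hq
  have hmem : ∀ k, y k ∈ span ℝ ({q} : Set E3) := by
    intro k
    have h1 := hcond k
    rw [smul_zero, add_zero, smul_zero, add_zero] at h1
    set ck := 3 * ⟪q, y k⟫_ℝ / (2 * r k ^ 2) with hck
    have hck0 : ck ≠ 0 := by
      intro h0; rw [h0, zero_smul] at h1; exact hq h1
    have : y k = ck⁻¹ • q := by
      rw [h1, smul_smul, inv_mul_cancel₀ hck0, one_smul]
    rw [this]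
    exact smul_mem _ _ (subset_span rfl)
  have hW : Module.finrank ℝ (span ℝ ({q} : Set E3)) ≤ 2 := by
    have h := finrank_span_pair_le_two q q
    rwa [Set.pair_eq_singleton] at h
  exact false_of_linearIndependent_three_mem (hind 0 1 2 (by decide) (by decide) (by decide)) hW
    (hmem 0) (hmem 1) (hmem 2)

end Rigidity

/-! ### (B2) assembled: the generator is Killing at four events in general position only if trivial -/

section Assembly

/-- **(B2) Four-event rigidity of the Lie derivative of the static Schwarzschild components.** Let
`M ≠ 0`, `p, q ∈ E4` (boost rate `p⃗` and translation `q`; `ω = e₀ ∧ p`, `Z(x) = ωx + q`, whose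
spatial part at the event `x` is `q⃗ + x⁰ p⃗`), and let `x₀, …, x₃` be events off the time axis
whose spatial parts are in general position (every three linearly independent). If at each `xₖ`
`∂_{Vₖ} g + g(ω·, ·) + g(·, ω·) = 0` for a direction `Vₖ` with spatial part `q⃗ + xₖ⁰ p⃗`, then
`p⃗ = 0` and `q⃗ = 0`, i.e. `Z = q⁰ ∂_t` is the static Killing field
(`spatial_add_eq_of_lieDeriv_eq_zero` at each event and `eq_zero_of_four_point_conditions`).
With the principal-symbol kernel lemma (`…StubSlavingCOERSymbol`) this is the injectivity of the
`J²`-block of the jet ↦ Ricci map of a painted Schwarzschild summand at four lab points in general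
position, for every boost (the rest-frame images of lab events are again in general position).
[cite: KerrSchild1965, §2] -/
theorem spatial_eq_zero_of_lieDeriv_eq_zero_four_events {M : ℝ} (hM : M ≠ 0) (p q : E4)
    (x V : Fin 4 → E4) (hx : ∀ k, E4.spatial (x k) ≠ 0)
    (hind : ∀ i j k : Fin 4, i ≠ j → j ≠ k → i ≠ k →
      LinearIndependent ℝ ![E4.spatial (x i), E4.spatial (x j), E4.spatial (x k)])
    (hV : ∀ k, E4.spatial (V k) = E4.spatial q + (x k 0) • E4.spatial p)
    (h : ∀ k, ∀ A B : E4, fderiv ℝ (Kerr.bilin M 0) (x k) (V k) A B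
      + Kerr.bilin M 0 (x k) (E4.ofTimeSpace (sdot p A) (A 0 • E4.spatial p)) B
      + Kerr.bilin M 0 (x k) A (E4.ofTimeSpace (sdot p B) (B 0 • E4.spatial p)) = 0) :
    E4.spatial p = 0 ∧ E4.spatial q = 0 := by
  refine eq_zero_of_four_point_conditions (E4.spatial p) (E4.spatial q) (fun k ↦ E4.spatial (x k))
    (fun k ↦ x k 0) (fun k ↦ E4.spatialNorm (x k)) (fun k ↦ ?_) hind (fun k ↦ ?_)
  · rw [E4.spatialNorm, norm_ne_zero_iff]; exact hx k
  · have h1 := spatial_add_eq_of_lieDeriv_eq_zero hM (hx k) (h k)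
    rw [hV k, sdot, hV k, real_inner_comm] at h1
    rw [add_smul, ← add_assoc]
    exact h1

end Assembly

/-- **Registered one-line carrier form** (`coer_lieDeriv_four_event_rigidity_s0`) of
`spatial_eq_zero_of_lieDeriv_eq_zero_four_events`. [cite: KerrSchild1965, §2] -/
theorem coer_lieDeriv_four_event_rigidity_s0 : open Literature.Geometry.Lorentzian Literature.Geometry.Lorentzian.Schwarzschild in ∀ {M : ℝ}, M ≠ 0 → ∀ (p q : E4) (x V : Fin 4 → E4), (∀ k, E4.spatial (x k) ≠ 0) → (∀ i j k : Fin 4, i ≠ j → j ≠ k → i ≠ k → LinearIndependent ℝ ![E4.spatial (x i), E4.spatial (x j), E4.spatial (x k)]) → (∀ k, E4.spatial (V k) = E4.spatial q + (x k 0) • E4.spatial p) → (∀ k, ∀ A B : E4, fderiv ℝ (Kerr.bilin M 0) (x k) (V k) A B + Kerr.bilin M 0 (x k) (E4.ofTimeSpace (sdot p A) (A 0 • E4.spatial p)) B + Kerr.bilin M 0 (x k) A (E4.ofTimeSpace (sdot p B) (B 0 • E4.spatial p)) = 0) → E4.spatial p = 0 ∧ E4.spatial q = 0 :=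
  fun hM p q x V hx hind hV h ↦ spatial_eq_zero_of_lieDeriv_eq_zero_four_events hM p q x V hx hind hV h

end Summit.FinalStateConjecture.FinalStateConjecture.Theorems.SublinearIsFree.Slaving
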